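import Literature.Analysis.FluidPDE.NSLocalLerayFarFieldVorticity
import Mathlib.Geometry.Manifold.PartitionOfUnity
import HarnessLib

/-!
# The far-field vorticity of a local Leray solution at the final time of a slab: trace tools

Analysis/FluidPDE proof file (no new notions) in the decomposition of Lemarié-Rieusset 2016,
Thm. 15.4 **on a slab** (`lemarieRieusset_backward_uniqueness_slab`, `NSSereginMildFacts.lean`;
doi:10.1201/b19556, PDF p. 568, proof pp. 568–569), below the named fact
`localLeray_farField_vorticity_eq_zero_slab` (`NSLocalLerayBackwardUniquenessSlab.lean`, Steps
2–3 of the printed proof over the slab class `IsLocalLeraySolutionOn`). The sister file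
`NSLocalLerayFarFieldVorticity.lean` proves Step 3 for Jia–Šverák's *global* class from the
far-field regularity of Step 2 and Escauriaza–Seregin–Šverák's half-space backward uniqueness
(`ess_backward_uniqueness_C1`), using that a global solution is regular *across* the time `T₁`.
For a solution living only on the slab `(0, T₁)` the far-field representative is regular on the
open time interval `(T₄, T₁)` and the sentence "Finally, as `u(T₁, .) = 0`, we find that
`ω(T₁, x) = 0` for `x₃ > 2R`" (p. 569) needs the **trace of the vorticity at the final time**.
This file supplies it, as three tools:

* `integral_inner_curl_eq_of_contDiffOn` — integration by parts `∫ ⟪∇ ∧ F, Ψ⟫ = ∫ ⟪F, ∇ ∧ Ψ⟫`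
  for a field `F` that is `C¹` only on an open set `S` containing the support of the test field
  `Ψ` (smooth Urysohn cut-off `χ = 1` near `tsupport Ψ`, `χ = 0` near `Sᶜ`, from Mathlib's
  `exists_contMDiffMap_zero_one_nhds_of_isClosed`, and the tree's whole-space identity
  `integral_inner_curl_eq_integral_inner_curl`);
* `exists_continuousOn_extension_Ioc` — a field `ω` jointly `C¹` on `(T₄, T₁) × S` with
  `|∂ₜω| ≤ M₀` and `|∇ω| ≤ M₀` there is Lipschitz in `t` for each `x ∈ S`
  (`lipschitzOnWith_time_of_norm_timeDeriv_le`), hence has a limit `ω(T₁⁻, x)`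
  (`exists_tendsto_nhdsLT_of_lipschitzOnWith`, by Lipschitz extension), and
  `ω̄ = ω` on `t < T₁`, `ω̄(t, x) = ω(T₁⁻, x)` for `t ≥ T₁` is jointly continuous on
  `(T₄, T₁] × S` (an `ε/4` argument with the mean value inequality in `x`);
* `eqOn_zero_of_tendsto_curl_pairings` — **the trace vanishes**: if moreover
  `ω(t, ·) = ∇ ∧ U(t, ·)` on `S` with `U(t, ·)` of class `C¹` on `S`, `U = u` a.e. on
  `(T₄, T₁) × S`, and `u(t) → 0` in the sense of distributions as `t ↑ T₁`, then
  `ω(T₁⁻, ·) = 0` on `S`: for a test field `φ` supported in `S`, `∫ ⟪ω(t), φ⟫ → ∫ ⟪ω(T₁⁻), φ⟫`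
  (dominated convergence), while for a.e. `t`, `∫ ⟪ω(t), φ⟫ = ∫ ⟪U(t), ∇ ∧ φ⟫ = ∫ ⟪u(t), ∇ ∧ φ⟫`
  (the localized integration by parts and the a.e. identity), which tends to `0` along
  `𝓝[<] T₁ ⊓ ae` (`nhdsLT_inf_ae_neBot`); so `ω(T₁⁻, ·)` is orthogonal to all test fields
  supported in `S` (`eqOn_zero_of_integral_inner_test_eq_zero`).

## References

* P. G. Lemarié-Rieusset, *The Navier–Stokes Problem in the 21st Century* (2016),
  doi:10.1201/b19556: proof of Thm. 15.4, Step 3 (PDF p. 569).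
* L. Escauriaza, G. Seregin, V. Šverák, Russian Math. Surveys 58 (2003), Thm. 5.1 (the trace
  `ω(·, 0) = 0` in (5.2)).
-/

noncomputable section

open MeasureTheory TopologicalSpace Set Function Filter Metric
open _root_.Topology
open scoped ENNReal NNReal RealInnerProductSpace ContDiff Manifold

namespace Literature.Analysis.FluidPDE

/-! ### A smooth Urysohn cut-off and the localized integration by parts for the curl -/

/-- **Smooth Urysohn cut-off** in a finite-dimensional real normed space: for a compact `K`
inside an open `S` there is a smooth `χ` with `χ = 1` on a neighbourhood of `K` and `χ = 0` on a
neighbourhood of `Sᶜ` (Mathlib's `exists_contMDiffMap_zero_one_nhds_of_isClosed` on the model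
space, read back through `contMDiff_iff_contDiff`). [folklore] -/
theorem exists_contDiff_one_nhdsSet_zero_nhdsSet {E : Type*} [NormedAddCommGroup E]
    [NormedSpace ℝ E] [FiniteDimensional ℝ E] {K S : Set E} (hK : IsCompact K) (hS : IsOpen S)
    (hKS : K ⊆ S) :
    ∃ χ : E → ℝ, ContDiff ℝ ∞ χ ∧ (∀ᶠ x in 𝓝ˢ K, χ x = 1) ∧ ∀ᶠ x in 𝓝ˢ Sᶜ, χ x = 0 := by
  obtain ⟨f, hf0, hf1, -⟩ := exists_contMDiffMap_zero_one_nhds_of_isClosed (I := 𝓘(ℝ, E))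
    (M := E) (n := (⊤ : ℕ∞)) hS.isClosed_compl hK.isClosed
    (disjoint_compl_left_iff_subset.2 hKS)
  exact ⟨f, contMDiff_iff_contDiff.1 f.contMDiff, hf1, hf0⟩

/-- **Integration by parts for the curl, localized** (the curl is formally self-adjoint): if
`F` is of class `C¹` on an open set `S ⊆ ℝ³` and `Ψ` is a `C¹` field with compact support
`tsupport Ψ ⊆ S`, then `∫ ⟪∇ ∧ F, Ψ⟫ = ∫ ⟪F, ∇ ∧ Ψ⟫`. Reduction to the whole-space identity
`integral_inner_curl_eq_integral_inner_curl`: with a smooth cut-off `χ = 1` near `tsupport Ψ`,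
`χ = 0` near `Sᶜ`, the field `χ F` is `C¹` on `ℝ³`, has the same curl as `F` near `tsupport Ψ`,
and agrees with `F` on `tsupport (∇ ∧ Ψ) ⊆ tsupport Ψ`. [folklore] -/
theorem integral_inner_curl_eq_of_contDiffOn
    {F Ψ : EuclideanSpace ℝ (Fin 3) → EuclideanSpace ℝ (Fin 3)} {S : Set (EuclideanSpace ℝ (Fin 3))}
    (hS : IsOpen S) (hF : ContDiffOn ℝ 1 F S) (hΨ : ContDiff ℝ 1 Ψ) (hc : HasCompactSupport Ψ)
    (hΨS : tsupport Ψ ⊆ S) :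
    ∫ x, ⟪curl F x, Ψ x⟫ = ∫ x, ⟪F x, curl Ψ x⟫ := by
  obtain ⟨χ, hχ, h1, h0⟩ := exists_contDiff_one_nhdsSet_zero_nhdsSet hc hS hΨS
  set G : EuclideanSpace ℝ (Fin 3) → EuclideanSpace ℝ (Fin 3) := fun x => χ x • F x with hGdef
  -- `G = χ F` is `C¹` on the whole space
  have hG : ContDiff ℝ 1 G := by
    rw [contDiff_iff_contDiffAt]
    intro x
    by_cases hx : x ∈ S
    · exact (((hχ.of_le (by norm_cast)).contDiffOn (s := S)).smul hF).contDiffAt (hS.mem_nhds hx)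
    · have hev : ∀ᶠ y in 𝓝 x, χ y = 0 := h0.filter_mono (nhds_le_nhdsSet (mem_compl hx))
      have hG0 : (fun _ => (0 : EuclideanSpace ℝ (Fin 3))) =ᶠ[𝓝 x] G :=
        hev.mono fun y hy => by simp [hGdef, hy]
      exact contDiffAt_const.congr_of_eventuallyEq hG0.symm
  -- `curl G = curl F` against `Ψ`, and `G = F` against `curl Ψ`
  have hcurl : ∀ x, ⟪curl G x, Ψ x⟫ = ⟪curl F x, Ψ x⟫ := by
    intro x
    by_cases hx : x ∈ tsupport Ψ
    · have hev : G =ᶠ[𝓝 x] F :=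
        (h1.filter_mono (nhds_le_nhdsSet hx)).mono fun y hy => by simp [hGdef, hy]
      rw [curl_eq_curlCLM, hev.fderiv_eq, ← curl_eq_curlCLM]
    · rw [image_eq_zero_of_notMem_tsupport hx, inner_zero_right, inner_zero_right]
  have hGF : ∀ x, ⟪G x, curl Ψ x⟫ = ⟪F x, curl Ψ x⟫ := by
    intro x
    by_cases hx : x ∈ tsupport Ψ
    · have hx1 : χ x = 1 := (h1.filter_mono (nhds_le_nhdsSet hx)).self_of_nhds
      simp [hGdef, hx1]
    · rw [curl_eq_zero_of_notMem_tsupport hx, inner_zero_right, inner_zero_right]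
  calc ∫ x, ⟪curl F x, Ψ x⟫ = ∫ x, ⟪curl G x, Ψ x⟫ := by simp_rw [hcurl]
    _ = ∫ x, ⟪G x, curl Ψ x⟫ := integral_inner_curl_eq_integral_inner_curl hG hΨ hc
    _ = ∫ x, ⟪F x, curl Ψ x⟫ := by simp_rw [hGF]

/-- The curl of a field vanishes off its topological support, so
`tsupport (∇ ∧ φ) ⊆ tsupport φ`. [folklore] -/
theorem tsupport_curl_subset (φ : EuclideanSpace ℝ (Fin 3) → EuclideanSpace ℝ (Fin 3)) :
    tsupport (curl φ) ⊆ tsupport φ := by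
  refine closure_minimal (fun x hx => ?_) (isClosed_tsupport φ)
  by_contra h
  exact hx (curl_eq_zero_of_notMem_tsupport h)

/-- The curl of a test field is a test field. [folklore] -/
theorem isTestFunctionOn_curl {φ : EuclideanSpace ℝ (Fin 3) → EuclideanSpace ℝ (Fin 3)}
    (hφ : FunctionSpaces.IsTestFunctionOn (⊤ : Opens (EuclideanSpace ℝ (Fin 3))) φ) :
    FunctionSpaces.IsTestFunctionOn (⊤ : Opens (EuclideanSpace ℝ (Fin 3))) (curl φ) := by
  refine ⟨?_, hasCompactSupport_curl hφ.hasCompactSupport, by simp⟩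
  rw [curl_eq_curlCLM_comp]
  exact curlCLM.contDiff.comp (hφ.contDiff.fderiv_right le_rfl)

/-- A pairing `x ↦ ⟪V x, φ x⟫` with `V` continuous on an open set `S` and `φ` continuous with
`tsupport φ ⊆ S` is continuous on the whole space (off `tsupport φ` it vanishes near every
point). [folklore] -/
theorem continuous_inner_of_continuousOn_of_tsupport_subset
    {V φ : EuclideanSpace ℝ (Fin 3) → EuclideanSpace ℝ (Fin 3)} {S : Set (EuclideanSpace ℝ (Fin 3))}
    (hS : IsOpen S) (hV : ContinuousOn V S) (hφ : Continuous φ) (hφS : tsupport φ ⊆ S) :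
    Continuous fun x => ⟪V x, φ x⟫ := by
  rw [continuous_iff_continuousAt]
  intro x
  by_cases hx : x ∈ S
  · exact (hV.continuousAt (hS.mem_nhds hx)).inner hφ.continuousAt
  · have hx' : x ∉ tsupport φ := fun h => hx (hφS h)
    have h0 : (fun y => ⟪V y, φ y⟫) =ᶠ[𝓝 x] fun _ => 0 := by
      filter_upwards [notMem_tsupport_iff_eventuallyEq.1 hx'] with y hy
      simp [hy]
    exact (continuousAt_const (y := (0 : ℝ))).congr h0.symm

/-! ### Lipschitz continuity in time and the limit at the final time -/

/-- **A jointly `C¹` field with bounded time derivative is Lipschitz in time**: if `uncurry ω`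
is `C¹` on `(T₄, T₁) × S` (`S` open) and `‖∂ₜω‖ ≤ M₀` there, then for each `x ∈ S` the map
`t ↦ ω(t, x)` is `M₀`-Lipschitz on `(T₄, T₁)` (mean value inequality on the convex interval).
[folklore] -/
theorem lipschitzOnWith_time_of_norm_timeDeriv_le
    {om : ℝ → EuclideanSpace ℝ (Fin 3) → EuclideanSpace ℝ (Fin 3)} {T₄ T₁ : ℝ}
    {S : Set (EuclideanSpace ℝ (Fin 3))} (hS : IsOpen S)
    (hom : ContDiffOn ℝ 1 (uncurry om) (Ioo T₄ T₁ ×ˢ S)) {M₀ : ℝ}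
    (hM : ∀ t ∈ Ioo T₄ T₁, ∀ x ∈ S, ‖timeDeriv om t x‖ ≤ M₀) {x : EuclideanSpace ℝ (Fin 3)}
    (hx : x ∈ S) : LipschitzOnWith (Real.toNNReal M₀) (fun t => om t x) (Ioo T₄ T₁) := by
  have hopen : IsOpen (Ioo T₄ T₁ ×ˢ S) := isOpen_Ioo.prod hS
  refine (convex_Ioo T₄ T₁).lipschitzOnWith_of_nnnorm_deriv_le (𝕜 := ℝ) (fun t ht => ?_)
    (fun t ht => ?_)
  · have h1 : DifferentiableAt ℝ (uncurry om) (t, x) :=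
      (hom.contDiffAt (hopen.mem_nhds ⟨ht, hx⟩)).differentiableAt (by simp)
    have h2 : DifferentiableAt ℝ (fun r : ℝ => ((r, x) : ℝ × EuclideanSpace ℝ (Fin 3))) t := by
      fun_prop
    exact h1.comp t h2
  · have h := hM t ht x hx
    rw [timeDeriv_apply] at h
    rw [← NNReal.coe_le_coe, coe_nnnorm]
    exact h.trans (Real.le_coe_toNNReal M₀)

/-- **A Lipschitz function on `(T₄, T₁)` with values in `ℝ³` has a limit at `T₁⁻`** (extend it
to a Lipschitz function on `ℝ`, `LipschitzOnWith.extend_finite_dimension`, and evaluate at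
`T₁`). [folklore] -/
theorem exists_tendsto_nhdsLT_of_lipschitzOnWith {f : ℝ → EuclideanSpace ℝ (Fin 3)} {T₄ T₁ : ℝ}
    (hT : T₄ < T₁) {K : ℝ≥0} (hf : LipschitzOnWith K f (Ioo T₄ T₁)) :
    ∃ L : EuclideanSpace ℝ (Fin 3), Tendsto f (𝓝[<] T₁) (𝓝 L) := by
  obtain ⟨g, hg, hfg⟩ := hf.extend_finite_dimension
  refine ⟨g T₁, ?_⟩
  have h1 : Tendsto g (𝓝[<] T₁) (𝓝 (g T₁)) :=
    hg.continuous.continuousAt.tendsto.mono_left nhdsWithin_le_nhds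
  refine h1.congr' ?_
  filter_upwards [Ioo_mem_nhdsLT hT] with t ht
  exact (hfg ht).symm

/-- **Continuous extension of the far-field vorticity to the final time** (the object
`ω(T₁, ·)` of Lemarié-Rieusset 2016, proof of Thm. 15.4, Step 3, p. 569, for a solution living
on the slab only): let `uncurry ω` be `C¹` on `(T₄, T₁) × S` (`T₄ < T₁`, `S` open) with
`‖∂ₜω‖ ≤ M₀` and `‖∇ω‖ ≤ M₀` there. Then there is `ω̄ : ℝ → ℝ³ → ℝ³` with `ω̄(t, ·) = ω(t, ·)`
for `t < T₁`, `uncurry ω̄` continuous on `(T₄, T₁] × S`, and `ω(t, x) → ω̄(T₁, x)` as `t ↑ T₁`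
for every `x ∈ S`. (Lipschitz in `t` gives the limit; joint continuity at `(T₁, x₀)` is an
`ε/4`-argument with the mean value inequality `‖ω(t, x) - ω(t, x₀)‖ ≤ M₀‖x - x₀‖` on a ball
around `x₀` inside `S`, passed to the limit `t ↑ T₁`.) [cite: LemarieRieusset2016, proof of Thm. 15.4, Step 3 (PDF p. 569)] -/
theorem exists_continuousOn_extension_Ioc
    {om : ℝ → EuclideanSpace ℝ (Fin 3) → EuclideanSpace ℝ (Fin 3)} {T₄ T₁ : ℝ} (hT : T₄ < T₁)
    {S : Set (EuclideanSpace ℝ (Fin 3))} (hS : IsOpen S)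
    (hom : ContDiffOn ℝ 1 (uncurry om) (Ioo T₄ T₁ ×ˢ S)) {M₀ : ℝ}
    (hMt : ∀ t ∈ Ioo T₄ T₁, ∀ x ∈ S, ‖timeDeriv om t x‖ ≤ M₀)
    (hMx : ∀ t ∈ Ioo T₄ T₁, ∀ x ∈ S, ‖fderiv ℝ (om t) x‖ ≤ M₀) :
    ∃ omb : ℝ → EuclideanSpace ℝ (Fin 3) → EuclideanSpace ℝ (Fin 3),
      (∀ t < T₁, omb t = om t) ∧ ContinuousOn (uncurry omb) (Ioc T₄ T₁ ×ˢ S) ∧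
      ∀ x ∈ S, Tendsto (fun t => om t x) (𝓝[<] T₁) (𝓝 (omb T₁ x)) := by
  classical
  have hopen : IsOpen (Ioo T₄ T₁ ×ˢ S) := isOpen_Ioo.prod hS
  -- the limits `L x = om(T₁⁻, x)`, `x ∈ S`
  have hlim : ∀ x ∈ S, ∃ L : EuclideanSpace ℝ (Fin 3), Tendsto (fun t => om t x) (𝓝[<] T₁) (𝓝 L) :=
    fun x hx => exists_tendsto_nhdsLT_of_lipschitzOnWith hT
      (lipschitzOnWith_time_of_norm_timeDeriv_le hS hom hMt hx)
  choose! L hL using hlim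
  refine ⟨fun t x => if t < T₁ then om t x else L x, fun t ht => funext fun x => if_pos ht, ?_,
    fun x hx => by simpa only [lt_self_iff_false, if_false] using hL x hx⟩
  -- spatial differentiability and the mean value inequality on balls inside `S`
  have hdiffx : ∀ t ∈ Ioo T₄ T₁, ∀ y ∈ S, DifferentiableAt ℝ (om t) y := by
    intro t ht y hy
    have h1 : DifferentiableAt ℝ (uncurry om) (t, y) :=
      (hom.contDiffAt (hopen.mem_nhds ⟨ht, hy⟩)).differentiableAt (by simp)
    have h2 : DifferentiableAt ℝ (fun z : EuclideanSpace ℝ (Fin 3) => ((t, z) : ℝ × _)) y := by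
      fun_prop
    exact h1.comp y h2
  have hmv : ∀ {x₀ : EuclideanSpace ℝ (Fin 3)} {r : ℝ}, ball x₀ r ⊆ S → ∀ t ∈ Ioo T₄ T₁,
      ∀ x ∈ ball x₀ r, ‖om t x - om t x₀‖ ≤ M₀ * ‖x - x₀‖ := by
    intro x₀ r hrS t ht x hx
    rcases le_or_gt r 0 with hr | hr
    · exact absurd hx (by rw [Metric.ball_eq_empty.2 hr]; exact notMem_empty x)
    exact (convex_ball x₀ r).norm_image_sub_le_of_norm_fderiv_le
      (fun y hy => hdiffx t ht y (hrS hy)) (fun y hy => hMx t ht y (hrS hy))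
      (mem_ball_self hr) hx
  -- continuity
  rintro ⟨t₀, x₀⟩ ⟨ht₀, hx₀⟩
  rcases ht₀.2.lt_or_eq with hlt | heq
  · -- interior time: `omb = om` near `(t₀, x₀)`
    have hca : ContinuousAt (uncurry om) (t₀, x₀) :=
      hom.continuousOn.continuousAt (hopen.mem_nhds ⟨⟨ht₀.1, hlt⟩, hx₀⟩)
    have hev : uncurry om =ᶠ[𝓝 (t₀, x₀)]
        uncurry fun t x => if t < T₁ then om t x else L x := by
      have hopen' : IsOpen {z : ℝ × EuclideanSpace ℝ (Fin 3) | z.1 < T₁} :=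
        isOpen_lt continuous_fst continuous_const
      filter_upwards [hopen'.mem_nhds (show (t₀, x₀).1 < T₁ from hlt)] with z hz
      simp only [uncurry] at hz ⊢
      rw [if_pos hz]
    exact (hca.congr hev).continuousWithinAt
  · -- final time `t₀ = T₁`
    subst heq
    rw [Metric.continuousWithinAt_iff]
    intro ε hε
    -- `M₀ ≥ 0` (the region is non-empty)
    have hM₀ : 0 ≤ M₀ := by
      have hmid : (T₄ + t₀) / 2 ∈ Ioo T₄ t₀ := ⟨by linarith, by linarith⟩
      exact (norm_nonneg _).trans (hMt _ hmid x₀ hx₀)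
    -- a ball around `x₀` inside `S`, of radius `≤ ε / (4 (M₀ + 1))`
    obtain ⟨r, hr, hrS⟩ := Metric.isOpen_iff.1 hS x₀ hx₀
    set δ₁ : ℝ := min r (ε / (4 * (M₀ + 1))) with hδ₁
    have hδ₁pos : 0 < δ₁ := lt_min hr (by positivity)
    have hδ₁r : δ₁ ≤ r := min_le_left _ _
    have hδ₁ε : M₀ * δ₁ ≤ ε / 4 := by
      calc M₀ * δ₁ ≤ M₀ * (ε / (4 * (M₀ + 1))) :=
            mul_le_mul_of_nonneg_left (min_le_right _ _) hM₀
        _ = ε / 4 * (M₀ / (M₀ + 1)) := by field_simp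
        _ ≤ ε / 4 * 1 := by
            gcongr
            rw [div_le_one (by linarith)]; linarith
        _ = ε / 4 := mul_one _
    have hballS : ball x₀ δ₁ ⊆ S := (ball_subset_ball hδ₁r).trans hrS
    -- times close to `T₁` on which `om(t, x₀)` is `ε/4`-close to its limit
    obtain ⟨η, hη, hηlim⟩ := Metric.tendsto_nhdsWithin_nhds.1 (hL x₀ hx₀) (ε / 4) (by positivity)
    refine ⟨min δ₁ η, lt_min hδ₁pos hη, ?_⟩
    rintro ⟨t, x⟩ ⟨ht, hx⟩ hdist
    rw [Prod.dist_eq, max_lt_iff] at hdist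
    obtain ⟨hdt, hdx⟩ := hdist
    have hxball : x ∈ ball x₀ δ₁ := lt_of_lt_of_le hdx (min_le_left _ _)
    have hxS : x ∈ S := hballS hxball
    have hxx₀ : M₀ * ‖x - x₀‖ ≤ ε / 4 :=
      (mul_le_mul_of_nonneg_left (le_of_lt (mem_ball_iff_norm.1 hxball)) hM₀).trans hδ₁ε
    simp only [uncurry, lt_self_iff_false, if_false]
    rcases ht.2.lt_or_eq with hlt | heq
    · -- `t < T₁`: `‖om t x - L x₀‖ ≤ ‖om t x - om t x₀‖ + ‖om t x₀ - L x₀‖`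
      rw [if_pos hlt, dist_eq_norm]
      have htI : t ∈ Ioo T₄ t₀ := ⟨ht.1, hlt⟩
      have h1 : ‖om t x - om t x₀‖ ≤ ε / 4 := (hmv hballS t htI x hxball).trans hxx₀
      have h2 : dist (om t x₀) (L x₀) < ε / 4 := by
        refine hηlim hlt ?_
        rw [dist_eq_norm, Real.norm_eq_abs]
        rw [Real.dist_eq] at hdt
        exact lt_of_lt_of_le hdt (min_le_right _ _)
      rw [dist_eq_norm] at h2
      calc ‖om t x - L x₀‖ = ‖(om t x - om t x₀) + (om t x₀ - L x₀)‖ := by abel_nf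
        _ ≤ ‖om t x - om t x₀‖ + ‖om t x₀ - L x₀‖ := norm_add_le _ _
        _ < ε := by linarith
    · -- `t = T₁`: `‖L x - L x₀‖ ≤ M₀ ‖x - x₀‖` by passing to the limit
      subst heq
      rw [if_neg (lt_irrefl _), dist_eq_norm]
      have hlimsub : Tendsto (fun s => om s x - om s x₀) (𝓝[<] t) (𝓝 (L x - L x₀)) :=
        (hL x hxS).sub (hL x₀ hx₀)
      have hle : ‖L x - L x₀‖ ≤ M₀ * ‖x - x₀‖ := by
        refine le_of_tendsto hlimsub.norm ?_
        filter_upwards [Ioo_mem_nhdsLT hT] with s hs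
        exact hmv hballS s hs x hxball
      linarith

/-! ### The trace of the far-field vorticity at the final time vanishes -/

/-- **The far-field vorticity vanishes at the final time** (Lemarié-Rieusset 2016, proof of
Thm. 15.4, Step 3, PDF p. 569: "Finally, as `u(T₁, .) = 0`, we find that `ω(T₁, x) = 0` for
`x₃ > 2R`", for a solution living on the slab `(0, T₁)` only). Let `S` be open, `T₄ < T₁`; let
`U(t, ·)` be `C¹` on `S` with `ω(t, ·) = ∇ ∧ U(t, ·)` continuous on `S` and `‖ω‖ ≤ M₀` on
`(T₄, T₁) × S`; let `U = u` a.e. on `(T₄, T₁) × S`, where `∫ ⟪u(t), φ⟫ → 0` as `t ↑ T₁` for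
every test field `φ`; and let `ω(t, x) → L(x)` as `t ↑ T₁` for `x ∈ S`, `L` continuous on `S`.
Then `L = 0` on `S`. Proof: for a test field `φ` with `tsupport φ ⊆ S`,
`∫ ⟪ω(t), φ⟫ → ∫ ⟪L, φ⟫` by dominated convergence, while for a.e. `t ∈ (T₄, T₁)`,
`∫ ⟪ω(t), φ⟫ = ∫ ⟪U(t), ∇ ∧ φ⟫ = ∫ ⟪u(t), ∇ ∧ φ⟫ → 0` (`integral_inner_curl_eq_of_contDiffOn`,
`∇ ∧ φ` being a test field); the two limits are compared along the non-trivial filter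
`𝓝[<] T₁ ⊓ ae`, and `eqOn_zero_of_integral_inner_test_eq_zero` concludes.
[cite: LemarieRieusset2016, proof of Thm. 15.4, Step 3 (PDF p. 569)] -/
theorem eqOn_zero_of_tendsto_curl_pairings
    {U u om : ℝ → EuclideanSpace ℝ (Fin 3) → EuclideanSpace ℝ (Fin 3)}
    {L : EuclideanSpace ℝ (Fin 3) → EuclideanSpace ℝ (Fin 3)} {T₄ T₁ : ℝ} (hT : T₄ < T₁)
    {S : Set (EuclideanSpace ℝ (Fin 3))} (hS : IsOpen S)
    (hU1 : ∀ t ∈ Ioo T₄ T₁, ContDiffOn ℝ 1 (U t) S)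
    (homU : ∀ t ∈ Ioo T₄ T₁, ∀ x ∈ S, om t x = curl (U t) x)
    (homc : ∀ t ∈ Ioo T₄ T₁, ContinuousOn (om t) S) {M₀ : ℝ}
    (hM : ∀ t ∈ Ioo T₄ T₁, ∀ x ∈ S, ‖om t x‖ ≤ M₀)
    (hUu : uncurry U =ᵐ[volume.restrict (Ioo T₄ T₁ ×ˢ S)] uncurry u)
    (hfinal : ∀ φ : EuclideanSpace ℝ (Fin 3) → EuclideanSpace ℝ (Fin 3),
      FunctionSpaces.IsTestFunctionOn (⊤ : Opens (EuclideanSpace ℝ (Fin 3))) φ →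
        Tendsto (fun t => ∫ x, ⟪u t x, φ x⟫) (𝓝[<] T₁) (𝓝 0))
    (hL : ∀ x ∈ S, Tendsto (fun t => om t x) (𝓝[<] T₁) (𝓝 (L x))) (hLc : ContinuousOn L S) :
    EqOn L 0 S := by
  refine eqOn_zero_of_integral_inner_test_eq_zero hS hLc fun φ hφ hφS => ?_
  have hφ0 : ∀ x, x ∉ S → φ x = 0 := fun x hx =>
    image_eq_zero_of_notMem_tsupport fun h => hx (hφS h)
  -- (i) `∫ ⟪om t, φ⟫ → ∫ ⟪L, φ⟫` (dominated convergence)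
  have h1 : Tendsto (fun t => ∫ x, ⟪om t x, φ x⟫) (𝓝[<] T₁) (𝓝 (∫ x, ⟪L x, φ x⟫)) := by
    refine tendsto_integral_filter_of_dominated_convergence (fun x => M₀ * ‖φ x‖) ?_ ?_ ?_ ?_
    · filter_upwards [Ioo_mem_nhdsLT hT] with t ht
      exact (continuous_inner_of_continuousOn_of_tsupport_subset hS (homc t ht)
        hφ.contDiff.continuous hφS).aestronglyMeasurable
    · filter_upwards [Ioo_mem_nhdsLT hT] with t ht
      refine Eventually.of_forall fun x => ?_
      by_cases hx : x ∈ S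
      · exact (norm_inner_le_norm _ _).trans
          (mul_le_mul_of_nonneg_right (hM t ht x hx) (norm_nonneg _))
      · simp [hφ0 x hx]
    · exact ((hφ.contDiff.continuous.norm).integrable_of_hasCompactSupport
        hφ.hasCompactSupport.norm).const_mul M₀
    · refine Eventually.of_forall fun x => ?_
      by_cases hx : x ∈ S
      · exact (hL x hx).inner tendsto_const_nhds
      · simp only [hφ0 x hx, inner_zero_right]
        exact tendsto_const_nhds
  -- (ii) for a.e. `t ∈ (T₄, T₁)`: `∫ ⟪om t, φ⟫ = ∫ ⟪u t, curl φ⟫`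
  have hcφS : tsupport (curl φ) ⊆ S := (tsupport_curl_subset φ).trans hφS
  have h2 : ∀ᵐ t ∂(volume.restrict (Ioo T₄ T₁)),
      ∫ x, ⟪om t x, φ x⟫ = ∫ x, ⟪u t x, curl φ x⟫ := by
    filter_upwards [ae_slice_eq_of_ae_eq_prod hUu, ae_restrict_mem measurableSet_Ioo]
      with t ht htI
    calc ∫ x, ⟪om t x, φ x⟫ = ∫ x, ⟪curl (U t) x, φ x⟫ := by
          refine integral_congr_ae (Eventually.of_forall fun x => ?_)
          by_cases hx : x ∈ S
          · simp only [homU t htI x hx]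
          · simp only [hφ0 x hx, inner_zero_right]
      _ = ∫ x, ⟪U t x, curl φ x⟫ :=
          integral_inner_curl_eq_of_contDiffOn hS (hU1 t htI) (hφ.contDiff.of_le (by norm_cast))
            hφ.hasCompactSupport hφS
      _ = ∫ x, ⟪u t x, curl φ x⟫ := integral_inner_congr_of_ae_restrict hS.measurableSet ht hcφS
  -- (iii) `∫ ⟪u t, curl φ⟫ → 0`
  have h3 : Tendsto (fun t => ∫ x, ⟪u t x, curl φ x⟫) (𝓝[<] T₁) (𝓝 0) :=
    hfinal _ (isTestFunctionOn_curl hφ)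
  -- (iv) compare along `𝓝[<] T₁ ⊓ ae`
  haveI : (𝓝[<] T₁ ⊓ ae (volume : Measure ℝ)).NeBot := nhdsLT_inf_ae_neBot T₁
  have heq : (fun t => ∫ x, ⟪om t x, φ x⟫) =ᶠ[𝓝[<] T₁ ⊓ ae (volume : Measure ℝ)]
      fun t => ∫ x, ⟪u t x, curl φ x⟫ := by
    rw [ae_restrict_iff' measurableSet_Ioo] at h2
    have hmem : ∀ᶠ t in 𝓝[<] T₁ ⊓ ae (volume : Measure ℝ), t ∈ Ioo T₄ T₁ :=
      Eventually.filter_mono inf_le_left (Ioo_mem_nhdsLT hT)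
    filter_upwards [h2.filter_mono inf_le_right, hmem] with t ht hmem
    exact ht hmem
  exact tendsto_nhds_unique ((h1.mono_left inf_le_left).congr' heq) (h3.mono_left inf_le_left)

end Literature.Analysis.FluidPDE

end
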